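import Literature.AlgebraicGeometry.Motives.ProjectiveSpaceLinearSubst
import HarnessLib

/-!
# The coordinate embeddings `ℙⁿ_k ↪ ℙⁿ⁺¹_k` onto the coordinate hyperplanes `V₊(x_k)`

For a field `k` and `k₀ : Fin (n + 2)`, the substitution `x_{k₀} ↦ 0`, `x_{k₀.succAbove j} ↦ yⱼ`
is a SURJECTIVE graded `k`-algebra homomorphism `s : k[x₀, …, x_{n+1}] → k[y₀, …, yₙ]`
(`ProjectiveSpace.skipGraded`), the irrelevant ideal of the target is generated by its image
(`irrelevant_le_map_skipGraded`: `yⱼ = s(x_{k₀.succAbove j})`), so Mathlib's functoriality of `Proj`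
(`AlgebraicGeometry.Proj.map`) gives the **coordinate embedding**
`ProjectiveSpace.skipMap k₀ : ℙⁿ_k ⟶ ℙⁿ⁺¹_k` over `k` (`skipMapHom_comp_projToSpec`, checked on the
charts `D₊(s t)` by Mathlib `Proj.awayι_comp_map`), Hartshorne II Ex. 2.14 (c) / Ex. 3.12 (the
closed immersion `Proj S/I → Proj S` of a surjective graded map, here `S/I = k[x]/(x_{k₀}) ≅ k[y]`).
PROVED here:

* `pointOfVec_comp_skipMap` — **on field-valued points it is `[y₀ : … : yₙ] ↦ [y₀ : … : 0 : … : yₙ]`**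
  (a `0` inserted in slot `k₀`; through the dictionary `pointOfVec` of
  `Motives/ProjectiveSpaceFieldPoints`, chart by chart: `awayEval y ∘ Away.map s = awayEval (ins y)`);
* `skipMap_preimage_basicOpen` — `skipMap⁻¹ D₊(t) = D₊(s t)`, in particular
  `skipMap⁻¹ D₊(x_{k₀}) = ∅` and `skipMap⁻¹ D₊(x_{k₀.succAbove j}) = D₊(yⱼ)`;
* `range_skipMap_subset` — the image lies in `V₊(x_{k₀})`;
* `awayMap_skipGraded_surjective` — on the chart `D₊(yⱼ) → D₊(x_{k₀.succAbove j})` the comorphism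
  `Away.map s` is surjective (preimages by re-indexing `yⱼ ↦ x_{k₀.succAbove j}`, `unskip`), the
  ring-theoretic content of "closed immersion" (Hartshorne II Ex. 3.12 (a)).

* `isClosedImmersion_skipMap_left` — **`skipMap` is a closed immersion** (Zariski-local on the
  target: over `D₊(x_{k₀})` the source is empty, over `D₊(x_{k₀.succAbove j})` it is `Spec` of the
  surjection, by the chart square `basicOpenIsoSpec_inv_comp_resLE`);
* `range_skipMap` — **its image is exactly `V₊(x_{k₀})`** (the relevant homogeneous prime
  `unskip⁻¹(𝔭)` maps to `𝔭` for `𝔭 ∋ x_{k₀}`, `skipPreimagePoint`).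

## References

* R. Hartshorne, *Algebraic Geometry*, GTM 52 (1977): II Ex. 2.14 (b), (c), II Ex. 3.12 (a),
  II Example 7.1.1. [Hartshorne1977]
-/

noncomputable section

open CategoryTheory AlgebraicGeometry HomogeneousLocalization MvPolynomial

universe u

namespace Literature.AlgebraicGeometry.Motives

namespace ProjectiveSpace

variable {k : Type u} [Field k] {n : ℕ}

attribute [local instance] MvPolynomial.gradedAlgebra ProjBaseChange.algebraBase

/-- The grading of the target ring `k[x₀, …, x_{n+1}]` (`ℙⁿ⁺¹ = Proj 𝒜`). [folklore] -/
local notation "𝒜" => MvPolynomial.homogeneousSubmodule (Fin (n + 2)) k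

/-- The grading of the source ring `k[y₀, …, yₙ]` (`ℙⁿ = Proj ℬ`). [folklore] -/
local notation "ℬ" => MvPolynomial.homogeneousSubmodule (Fin (n + 1)) k

/-! ### The substitution `x_{k₀} ↦ 0`, `x_{k₀.succAbove j} ↦ yⱼ` -/

section Subst

variable (k₀ : Fin (n + 2))

/-- The substitution `x_{k₀} ↦ 0`, `x_{k₀.succAbove j} ↦ yⱼ`, as a family of linear forms (or `0`)
in `k[y₀, …, yₙ]` indexed by the variables of `k[x₀, …, x_{n+1}]`. [cite: Hartshorne1977, II Ex. 2.14] -/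
def skipSubst : Fin (n + 2) → MvPolynomial (Fin (n + 1)) k :=
  Fin.insertNth k₀ 0 fun j ↦ X j

/-- `skipSubst k₀ k₀ = 0`. [folklore] -/
@[simp] theorem skipSubst_self : skipSubst (k := k) k₀ k₀ = 0 := by
  simp [skipSubst]

/-- `skipSubst k₀ (k₀.succAbove j) = yⱼ`. [folklore] -/
@[simp] theorem skipSubst_succAbove (j : Fin (n + 1)) : skipSubst (k := k) k₀ (k₀.succAbove j) = X j := by
  simp [skipSubst]

/-- Each `skipSubst k₀ i` is homogeneous of degree `1` (a variable or `0`). [folklore] -/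
theorem isHomogeneous_skipSubst (i : Fin (n + 2)) : (skipSubst (k := k) k₀ i).IsHomogeneous 1 := by
  refine Fin.succAboveCases k₀ ?_ (fun j ↦ ?_) i
  · rw [skipSubst_self]; exact isHomogeneous_zero (Fin (n + 1)) k 1
  · rw [skipSubst_succAbove]; exact isHomogeneous_X k j

/-- **The surjective graded homomorphism `s : k[x₀, …, x_{n+1}] → k[y₀, …, yₙ]`,
`x_{k₀} ↦ 0`, `x_{k₀.succAbove j} ↦ yⱼ`** (Mathlib `MvPolynomial.aeval`; degrees are preserved by
`IsHomogeneous.aeval`). [cite: Hartshorne1977, II Ex. 3.12] -/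
def skipGraded : 𝒜 →+*ᵍ ℬ where
  __ := (aeval (skipSubst k₀) : MvPolynomial (Fin (n + 2)) k →ₐ[k] MvPolynomial (Fin (n + 1)) k).toRingHom
  map_mem {i x} hx := by
    have h := ((mem_homogeneousSubmodule i x).mp hx).aeval (skipSubst (k := k) k₀) (isHomogeneous_skipSubst k₀)
    rw [one_mul] at h
    exact (mem_homogeneousSubmodule i _).mpr h

/-- `skipGraded k₀` is `aeval (skipSubst k₀)` on elements (`rfl`). [folklore] -/
@[simp] theorem skipGraded_apply (p : MvPolynomial (Fin (n + 2)) k) :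
    skipGraded k₀ p = aeval (skipSubst k₀) p := rfl

/-- `s(x_{k₀}) = 0`. [cite: Hartshorne1977, II Ex. 3.12] -/
theorem skipGraded_X_self : skipGraded k₀ (X k₀ : MvPolynomial (Fin (n + 2)) k) = 0 := by
  rw [skipGraded_apply, aeval_X, skipSubst_self]

/-- `s(x_{k₀.succAbove j}) = yⱼ`. [cite: Hartshorne1977, II Ex. 3.12] -/
theorem skipGraded_X_succAbove (j : Fin (n + 1)) :
    skipGraded k₀ (X (k₀.succAbove j) : MvPolynomial (Fin (n + 2)) k) = X j := by
  rw [skipGraded_apply, aeval_X, skipSubst_succAbove]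

/-- `s` fixes the constants. [folklore] -/
theorem skipGraded_C (c : k) : skipGraded k₀ (C c : MvPolynomial (Fin (n + 2)) k) = C c := by
  rw [skipGraded_apply, aeval_C, MvPolynomial.algebraMap_eq]

/-- The re-indexing `yⱼ ↦ x_{k₀.succAbove j}` (Mathlib `rename`), a section of `s`. [folklore] -/
def unskip : MvPolynomial (Fin (n + 1)) k →ₐ[k] MvPolynomial (Fin (n + 2)) k :=
  rename k₀.succAbove

/-- `s ∘ unskip = id`. [folklore] -/
theorem skipGraded_unskip (p : MvPolynomial (Fin (n + 1)) k) : skipGraded k₀ (unskip k₀ p) = p := by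
  rw [skipGraded_apply, unskip, aeval_rename]
  have : (skipSubst (k := k) k₀ ∘ k₀.succAbove) = X := funext fun j ↦ skipSubst_succAbove k₀ j
  rw [this, aeval_X_left, AlgHom.id_apply]

/-- `unskip` preserves degrees. [folklore] -/
theorem unskip_mem {i : ℕ} {p : MvPolynomial (Fin (n + 1)) k} (hp : p ∈ ℬ i) : unskip k₀ p ∈ 𝒜 i := by
  rw [mem_homogeneousSubmodule] at hp ⊢
  exact MvPolynomial.IsHomogeneous.rename_isHomogeneous hp

open HomogeneousIdeal in
/-- **The irrelevant ideal of `k[y]` is generated by the image of that of `k[x]`** (the hypothesis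
of Mathlib's `Proj.map`): each homogeneous `y` of positive degree is `s (unskip y)` with `unskip y`
of the same positive degree. [folklore] -/
theorem irrelevant_le_map_skipGraded : ℬ₊ ≤ (𝒜₊).map (skipGraded k₀) := by
  rw [← toIdeal_le_toIdeal_iff, irrelevant_eq_span, Ideal.span_le, toIdeal_map]
  intro x hx
  simp only [Set.mem_iUnion, SetLike.mem_coe, exists_prop] at hx
  obtain ⟨i, hi, hx⟩ := hx
  rw [SetLike.mem_coe, show x = skipGraded k₀ (unskip k₀ x) from (skipGraded_unskip k₀ x).symm]
  exact Ideal.mem_map_of_mem _ (mem_irrelevant_of_mem _ hi (unskip_mem k₀ hx))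

/-- **The coordinate embedding `ℙⁿ_k → ℙⁿ⁺¹_k` as a morphism of schemes** (Mathlib `Proj.map` of
the surjective graded homomorphism `s`). [cite: Hartshorne1977, II Ex. 3.12] -/
def skipMapHom : Proj ℬ ⟶ Proj 𝒜 :=
  Proj.map (skipGraded k₀) (irrelevant_le_map_skipGraded k₀)

/-- `skipMapHom` is Mathlib's `Proj.map` (`rfl`). [folklore] -/
theorem skipMapHom_eq :
    skipMapHom k₀ = Proj.map (skipGraded k₀) (irrelevant_le_map_skipGraded (k := k) k₀) := rfl

/-- On `k[x]_{(t)} → k[y]_{(s t)}` the map of homogeneous localizations induced by `s`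
(Mathlib `Away.map`) is compatible with the `k`-algebra structures. [folklore] -/
theorem awayMap_skipGraded_algebraMap (t : MvPolynomial (Fin (n + 2)) k) (c : k) :
    Away.map (skipGraded k₀) t (algebraMap k (Away 𝒜 t) c) =
      algebraMap k (Away ℬ (skipGraded k₀ t)) c := by
  rw [ProjBaseChange.algebraMap_eq', ProjBaseChange.algebraMap_eq', Away.map,
    HomogeneousLocalization.map_mk]
  congr 1
  refine HomogeneousLocalization.NumDenSameDeg.ext _ rfl ?_ ?_
  · change skipGraded k₀ ((algebraMap k (𝒜 0) c : 𝒜 0) : MvPolynomial (Fin (n + 2)) k) =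
      ((algebraMap k (ℬ 0) c : ℬ 0) : MvPolynomial (Fin (n + 1)) k)
    rw [SetLike.GradeZero.coe_algebraMap, SetLike.GradeZero.coe_algebraMap, MvPolynomial.algebraMap_eq,
      MvPolynomial.algebraMap_eq, skipGraded_C]
  · change skipGraded k₀ (1 : MvPolynomial (Fin (n + 2)) k) = 1
    exact map_one _

/-- On the chart `D₊(s t) → D₊(t)` the embedding is `Spec (Away.map s t)`, a morphism over `Spec k`
(Mathlib `Proj.awayι_comp_map`). [folklore] -/
theorem awayι_comp_skipMapHom_comp_projToSpec {i : ℕ} (hi : 0 < i) (t : MvPolynomial (Fin (n + 2)) k)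
    (ht : t ∈ 𝒜 i) :
    Proj.awayι ℬ (skipGraded k₀ t) ((skipGraded k₀).map_mem ht) hi ≫ skipMapHom k₀ ≫
        ProjBaseChangeRing.projToSpec (Fin (n + 2)) k =
      Proj.awayι ℬ (skipGraded k₀ t) ((skipGraded k₀).map_mem ht) hi ≫
        ProjBaseChangeRing.projToSpec (Fin (n + 1)) k := by
  rw [skipMapHom_eq, Proj.awayι_comp_map_assoc _ _ hi t ht, ProjBaseChangeRing.awayι_projToSpec,
    ProjBaseChangeRing.awayι_projToSpec, ← Spec.map_comp, ← CommRingCat.ofHom_comp]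
  congr 2
  exact RingHom.ext fun c ↦ awayMap_skipGraded_algebraMap k₀ t c

/-- **`skipMapHom` is a morphism over `Spec k`** (checked on the open cover of the source by the
`D₊(s t)`, Mathlib `Proj.mapAffineOpenCover`). [folklore] -/
theorem skipMapHom_comp_projToSpec :
    skipMapHom k₀ ≫ ProjBaseChangeRing.projToSpec (Fin (n + 2)) k =
      ProjBaseChangeRing.projToSpec (Fin (n + 1)) k := by
  refine (Proj.mapAffineOpenCover (skipGraded k₀)
    (irrelevant_le_map_skipGraded k₀)).openCover.hom_ext _ _ fun s ↦ ?_
  rw [Scheme.AffineOpenCover.openCover_f, Proj.mapAffineOpenCover_f]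
  exact awayι_comp_skipMapHom_comp_projToSpec (k := k) k₀ s.1.2 s.2 s.2.2

/-- **The coordinate embedding `ℙⁿ_k ↪ ℙⁿ⁺¹_k` over `k`**, `[y] ↦ [y with 0 inserted in slot k₀]`.
[cite: Hartshorne1977, II Ex. 3.12] [cite: Hartshorne1977, II Ex. 2.14] -/
def skipMap : projectiveSpace n k ⟶ projectiveSpace (n + 1) k :=
  Over.homMk (skipMapHom k₀) (skipMapHom_comp_projToSpec k₀)

/-- The underlying morphism of `skipMap` is `Proj.map s`. [folklore] -/
@[simp]
theorem skipMap_left : (skipMap (k := k) k₀).left = skipMapHom k₀ := rfl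

/-- `skipMap` pulls the basic open `D₊(t)` back to `D₊(s t)` (Mathlib `Proj.map_preimage_basicOpen`).
[folklore] -/
theorem skipMap_preimage_basicOpen (t : MvPolynomial (Fin (n + 2)) k) :
    (skipMap k₀).left ⁻¹ᵁ Proj.basicOpen 𝒜 t = Proj.basicOpen ℬ (skipGraded k₀ t) :=
  rfl

/-- `skipMap⁻¹ D₊(x_{k₀}) = ∅`: the image misses the chart of the skipped coordinate. [folklore] -/
theorem skipMap_preimage_basicOpen_X_self :
    (skipMap k₀).left ⁻¹ᵁ Proj.basicOpen 𝒜 (X k₀) = ⊥ := by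
  rw [skipMap_preimage_basicOpen, skipGraded_X_self, Proj.basicOpen_zero]
  rfl

/-- **The image of the coordinate embedding lies in the coordinate hyperplane `V₊(x_{k₀})`.**
[cite: Hartshorne1977, II Ex. 3.12] -/
theorem range_skipMap_subset :
    Set.range (skipMap (k := k) k₀).left ⊆ ProjectiveSpectrum.zeroLocus 𝒜 {X k₀} := by
  rintro _ ⟨p, rfl⟩
  change ({X k₀} : Set (MvPolynomial (Fin (n + 2)) k)) ⊆
    (((skipMap k₀).left p : ProjectiveSpectrum 𝒜)).asHomogeneousIdeal
  rw [Set.singleton_subset_iff]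
  by_contra h
  have hmem : (skipMap k₀).left p ∈ Proj.basicOpen 𝒜 (X k₀) := (Proj.mem_basicOpen 𝒜 _ _).mpr h
  have : p ∈ (skipMap k₀).left ⁻¹ᵁ Proj.basicOpen 𝒜 (X k₀) := hmem
  rw [skipMap_preimage_basicOpen_X_self] at this
  exact this

/-- **Surjectivity of the comorphism on the charts**: `Away.map s x_{k₀.succAbove j} :
k[x]_{(x_{k₀.succAbove j})} → k[y]_{(yⱼ)}` is onto (a fraction `g/yⱼᵐ` is the image of
`unskip g / x_{k₀.succAbove j}ᵐ`) — the ring-theoretic content of "`skipMap` is a closed immersion".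
[cite: Hartshorne1977, II Ex. 3.12] -/
theorem awayMap_skipGraded_surjective (j : Fin (n + 1)) :
    Function.Surjective (Away.map (skipGraded k₀) (X (k₀.succAbove j) : MvPolynomial (Fin (n + 2)) k)) := by
  intro q
  -- write `q = g / yⱼ^m` in `Away ℬ (s x_{k₀.succAbove j}) = Away ℬ yⱼ`
  have hXj : (skipGraded k₀ (X (k₀.succAbove j) : MvPolynomial (Fin (n + 2)) k)) ∈ ℬ 1 :=
    (skipGraded k₀).map_mem (X_mem (k₀.succAbove j))
  obtain ⟨m, g, hg, rfl⟩ := Away.mk_surjective ℬ hXj q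
  refine ⟨Away.mk 𝒜 (X_mem (k₀.succAbove j)) m (unskip k₀ g) (unskip_mem k₀ hg), ?_⟩
  rw [Away.map_mk]
  congr 1
  · exact skipGraded_unskip k₀ g

end Subst

/-! ### The action on field-valued points -/

section Points

variable {L : Type u} [Field L] [Algebra k L] (k₀ : Fin (n + 2))

/-- Inserting `0` in slot `k₀`: the homogeneous coordinates of the image point. [folklore] -/
def insertZero (y : Fin (n + 1) → L) : Fin (n + 2) → L := Fin.insertNth k₀ 0 y

/-- `insertZero k₀ y k₀ = 0`. [folklore] -/
@[simp] theorem insertZero_self (y : Fin (n + 1) → L) : insertZero k₀ y k₀ = 0 := by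
  simp [insertZero]

/-- `insertZero k₀ y (k₀.succAbove j) = yⱼ`. [folklore] -/
@[simp] theorem insertZero_succAbove (y : Fin (n + 1) → L) (j : Fin (n + 1)) :
    insertZero k₀ y (k₀.succAbove j) = y j := by
  simp [insertZero]

/-- `insertZero k₀ y ≠ 0` for `y ≠ 0`. [folklore] -/
theorem insertZero_ne_zero {y : Fin (n + 1) → L} (hy : y ≠ 0) : insertZero k₀ y ≠ 0 := by
  obtain ⟨j, hj⟩ := Function.ne_iff.mp hy
  exact Function.ne_iff.mpr ⟨k₀.succAbove j, by rwa [insertZero_succAbove]⟩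

/-- `(s g)(y) = g(insertZero y)`: evaluating the substituted polynomial (Mathlib `comp_aeval`).
[folklore] -/
theorem aeval_skipGraded_eq (y : Fin (n + 1) → L) (g : MvPolynomial (Fin (n + 2)) k) :
    aeval y (skipGraded k₀ g) = aeval (insertZero k₀ y) g := by
  rw [skipGraded_apply, ← AlgHom.comp_apply, MvPolynomial.comp_aeval]
  have h : (fun i ↦ aeval y (skipSubst (k := k) k₀ i)) = insertZero k₀ y := by
    funext i
    refine Fin.succAboveCases k₀ ?_ (fun j ↦ ?_) i
    · rw [skipSubst_self, map_zero, insertZero_self]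
    · rw [skipSubst_succAbove, aeval_X, insertZero_succAbove]
  rw [h]

/-- **Evaluation at `y` after `Away.map s xᵢ` is evaluation at `insertZero y`**: the comorphism
of the coordinate embedding on the charts `D₊(s xᵢ) → D₊(xᵢ)`, composed with an `L`-point.
[folklore] -/
theorem awayEval_comp_awayMap_skipGraded (y : Fin (n + 1) → L) (i : Fin (n + 2))
    (hy : aeval y (skipGraded k₀ (X i : MvPolynomial (Fin (n + 2)) k)) ≠ 0)
    (hy' : aeval (insertZero k₀ y) (X i : MvPolynomial (Fin (n + 2)) k) ≠ 0) :
    (awayEval y hy).toRingHom.comp (Away.map (skipGraded k₀) (X i : MvPolynomial (Fin (n + 2)) k)) =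
      (awayEval (insertZero k₀ y) hy').toRingHom := by
  ext q
  obtain ⟨m, g, hg, rfl⟩ := q.mk_surjective _ (X_mem i)
  rw [RingHom.comp_apply, Away.map_mk]
  change awayEval y hy _ = awayEval (insertZero k₀ y) hy' _
  rw [awayEval_mk, awayEval_mk, aeval_skipGraded_eq, aeval_skipGraded_eq]

/-- **The coordinate embedding on points: `[y₀ : … : yₙ] ↦ [y₀ : … : 0 : … : yₙ]`** (`0` in slot
`k₀`; Hartshorne II Ex. 2.14 (b)). [cite: Hartshorne1977, II Ex. 2.14] -/
theorem pointOfVec_comp_skipMap (y : Fin (n + 1) → L) (hy : y ≠ 0) :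
    pointOfVec k y hy ≫ skipMap k₀ = pointOfVec k (insertZero k₀ y) (insertZero_ne_zero k₀ hy) := by
  obtain ⟨j, hj⟩ := Function.ne_iff.mp hy
  have hi' : aeval (insertZero k₀ y) (X (k₀.succAbove j) : MvPolynomial _ k) ≠ 0 :=
    aeval_X_ne_zero (by rwa [insertZero_succAbove])
  have hyi : aeval y (skipGraded k₀ (X (k₀.succAbove j) : MvPolynomial (Fin (n + 2)) k)) ≠ 0 := by
    rwa [aeval_skipGraded_eq]
  rw [pointOfVec_eq_chartPoint y hy ((skipGraded k₀).map_mem (X_mem (k₀.succAbove j))) one_pos hyi,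
    pointOfVec_eq_chartPoint _ (insertZero_ne_zero k₀ hy) (X_mem (k₀.succAbove j)) one_pos hi']
  ext : 1
  rw [Over.comp_left, chartPoint_left, chartPoint_left, skipMap_left, skipMapHom_eq]
  change (Spec.map (CommRingCat.ofHom (awayEval y hyi).toRingHom) ≫
      Proj.awayι ℬ (skipGraded k₀ (X (k₀.succAbove j)))
        ((skipGraded k₀).map_mem (X_mem (k₀.succAbove j))) one_pos) ≫
        Proj.map (skipGraded k₀) (irrelevant_le_map_skipGraded k₀) =
    Spec.map (CommRingCat.ofHom (awayEval (insertZero k₀ y) hi').toRingHom) ≫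
      Proj.awayι 𝒜 (X (k₀.succAbove j)) (X_mem (k₀.succAbove j)) one_pos
  rw [Category.assoc, Proj.awayι_comp_map _ _ one_pos (X (k₀.succAbove j)) (X_mem (k₀.succAbove j)),
    ← Category.assoc, ← Spec.map_comp, ← CommRingCat.ofHom_comp,
    awayEval_comp_awayMap_skipGraded k₀ y (k₀.succAbove j) hyi hi']

end Points

/-! ### `skipMap` is a closed immersion -/

section ClosedImmersion

variable (k₀ : Fin (n + 2))

/-- `skipMapHom⁻¹ D₊(x_{k₀}) = ∅`. [folklore] -/
theorem skipMapHom_preimage_basicOpen_X_self :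
    skipMapHom (k := k) k₀ ⁻¹ᵁ Proj.basicOpen 𝒜 (X k₀) = ⊥ := by
  change Proj.basicOpen ℬ (skipGraded k₀ (X k₀)) = ⊥
  rw [skipGraded_X_self, Proj.basicOpen_zero]

/-- Over the chart `D₊(x_{k₀})` the restriction of `skipMapHom` has empty source (its preimage is
`D₊(0) = ∅`), hence is a closed immersion. [folklore] -/
theorem isClosedImmersion_morphismRestrict_self :
    IsClosedImmersion (skipMapHom (k := k) k₀ ∣_ Proj.basicOpen 𝒜 (X k₀)) := by
  haveI : IsEmpty ↑(skipMapHom (k := k) k₀ ⁻¹ᵁ Proj.basicOpen 𝒜 (X k₀)) := by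
    rw [skipMapHom_preimage_basicOpen_X_self]
    exact ⟨fun x ↦ x.2⟩
  infer_instance

/-- **The chart square**: on `D₊(yⱼ) = skipMapHom⁻¹ D₊(x_{k₀.succAbove j})` the restriction of
`skipMapHom` (Mathlib `Scheme.Hom.resLE`), conjugated by the isomorphisms `D₊ ≅ Spec (Away)`
(Mathlib `Proj.basicOpenIsoSpec`), is `Spec` of the comorphism `Away.map s x_{k₀.succAbove j}`
(Mathlib `Proj.awayι_comp_map`, `Proj.ι_comp_map`). [folklore] -/
theorem basicOpenIsoSpec_inv_comp_resLE (j : Fin (n + 1)) :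
    (Proj.basicOpenIsoSpec ℬ (skipGraded k₀ (X (k₀.succAbove j)))
        ((skipGraded k₀).map_mem (X_mem (k₀.succAbove j))) one_pos).inv ≫
        (skipMapHom (k := k) k₀).resLE (Proj.basicOpen 𝒜 (X (k₀.succAbove j)))
          (Proj.basicOpen ℬ (skipGraded k₀ (X (k₀.succAbove j)))) le_rfl =
      Spec.map (CommRingCat.ofHom (Away.map (skipGraded k₀) (X (k₀.succAbove j) : MvPolynomial (Fin (n + 2)) k))) ≫
        (Proj.basicOpenIsoSpec 𝒜 (X (k₀.succAbove j)) (X_mem (k₀.succAbove j)) one_pos).inv := by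
  have h1 : (skipMapHom (k := k) k₀).resLE (Proj.basicOpen 𝒜 (X (k₀.succAbove j)))
      (Proj.basicOpen ℬ (skipGraded k₀ (X (k₀.succAbove j)))) le_rfl ≫
        (Proj.basicOpen 𝒜 (X (k₀.succAbove j) : MvPolynomial (Fin (n + 2)) k)).ι =
      (Proj.basicOpen ℬ (skipGraded k₀ (X (k₀.succAbove j)))).ι ≫ skipMapHom (k := k) k₀ :=
    (Proj.ι_comp_map (skipGraded k₀) (irrelevant_le_map_skipGraded k₀) (X (k₀.succAbove j))).symm
  rw [← cancel_mono (Proj.basicOpen 𝒜 (X (k₀.succAbove j) : MvPolynomial (Fin (n + 2)) k)).ι,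
    Category.assoc, Category.assoc, h1, Proj.basicOpenIsoSpec_inv_ι_assoc, Proj.basicOpenIsoSpec_inv_ι]
  unfold skipMapHom
  rw [Proj.awayι_comp_map _ _ one_pos (X (k₀.succAbove j)) (X_mem (k₀.succAbove j))]

/-- Over the chart `D₊(x_{k₀.succAbove j})` the restriction of `skipMapHom` is a closed immersion
(`Spec` of the surjection `Away.map s x_{k₀.succAbove j}`, `awayMap_skipGraded_surjective`,
Mathlib `IsClosedImmersion.spec_of_surjective`; closed immersions respect isomorphisms).
[cite: Hartshorne1977, II Ex. 3.12] -/
theorem isClosedImmersion_morphismRestrict_succAbove (j : Fin (n + 1)) :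
    IsClosedImmersion (skipMapHom (k := k) k₀ ∣_ Proj.basicOpen 𝒜 (X (k₀.succAbove j))) := by
  have hspec : IsClosedImmersion (Spec.map (CommRingCat.ofHom
      (Away.map (skipGraded k₀) (X (k₀.succAbove j) : MvPolynomial (Fin (n + 2)) k)))) :=
    IsClosedImmersion.spec_of_surjective _ (awayMap_skipGraded_surjective k₀ j)
  have h2 : IsClosedImmersion (Spec.map (CommRingCat.ofHom
      (Away.map (skipGraded k₀) (X (k₀.succAbove j) : MvPolynomial (Fin (n + 2)) k))) ≫
        (Proj.basicOpenIsoSpec 𝒜 (X (k₀.succAbove j)) (X_mem (k₀.succAbove j)) one_pos).inv) :=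
    (MorphismProperty.cancel_right_of_respectsIso @IsClosedImmersion _ _).mpr hspec
  rw [← basicOpenIsoSpec_inv_comp_resLE k₀ j] at h2
  have h3 := (MorphismProperty.cancel_left_of_respectsIso @IsClosedImmersion _ _).mp h2
  have key : skipMapHom (k := k) k₀ ∣_ Proj.basicOpen 𝒜 (X (k₀.succAbove j)) =
      (skipMapHom (k := k) k₀).resLE (Proj.basicOpen 𝒜 (X (k₀.succAbove j)))
        (Proj.basicOpen ℬ (skipGraded k₀ (X (k₀.succAbove j)))) le_rfl :=
    (Scheme.Hom.resLE_eq_morphismRestrict (skipMapHom (k := k) k₀)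
      (U := Proj.basicOpen 𝒜 (X (k₀.succAbove j)))).symm
  rw [key]
  exact h3

/-- **The coordinate embedding is a closed immersion** (closed immersions are Zariski-local on the
target; over the cover by the `D₊(xᵢ)` it is either empty or `Spec` of a surjection; Hartshorne
II Ex. 3.12 (a): "`Proj S/I → Proj S` is a closed immersion" for `S/I = k[x]/(x_{k₀}) ≅ k[y]`).
[cite: Hartshorne1977, II Ex. 3.12] -/
instance isClosedImmersion_skipMapHom : IsClosedImmersion (skipMapHom (k := k) k₀) := by
  refine (IsZariskiLocalAtTarget.iff_of_iSup_eq_top (P := @IsClosedImmersion)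
    (fun i : Fin (n + 2) ↦ Proj.basicOpen 𝒜 (X i : MvPolynomial (Fin (n + 2)) k))
    (Proj.iSup_basicOpen_eq_top 𝒜 _ (irrelevant_le_span (n + 1) k))).mpr fun i ↦ ?_
  rcases Fin.eq_self_or_eq_succAbove k₀ i with rfl | ⟨j, rfl⟩
  · exact isClosedImmersion_morphismRestrict_self i
  · exact isClosedImmersion_morphismRestrict_succAbove k₀ j

/-- `skipMap` is a closed immersion of `k`-schemes. [cite: Hartshorne1977, II Ex. 3.12] -/
instance isClosedImmersion_skipMap_left : IsClosedImmersion (skipMap (k := k) k₀).left :=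
  inferInstanceAs (IsClosedImmersion (skipMapHom k₀))

end ClosedImmersion

/-! ### The image of `skipMap` is the hyperplane `V₊(x_{k₀})` -/

section Range

variable (k₀ : Fin (n + 2))

/-- `unskip` as a graded homomorphism `k[y₀, …, yₙ] → k[x₀, …, x_{n+1}]`. [folklore] -/
def unskipGraded : ℬ →+*ᵍ 𝒜 where
  __ := (unskip k₀ : MvPolynomial (Fin (n + 1)) k →ₐ[k] MvPolynomial (Fin (n + 2)) k).toRingHom
  map_mem hx := unskip_mem k₀ hx

/-- `unskipGraded` on elements (`rfl`). [folklore] -/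
@[simp] theorem unskipGraded_apply (p : MvPolynomial (Fin (n + 1)) k) : unskipGraded k₀ p = unskip k₀ p := rfl

/-- `unskip (s a) ≡ a` modulo `(x_{k₀})`: the two `k`-algebra maps `a ↦ a` and `a ↦ unskip (s a)`
to `k[x]/(x_{k₀})` agree on the variables. [folklore] -/
theorem sub_unskip_skipGraded_mem (a : MvPolynomial (Fin (n + 2)) k) :
    a - unskip k₀ (skipGraded k₀ a) ∈ Ideal.span {(X k₀ : MvPolynomial (Fin (n + 2)) k)} := by
  rw [← Ideal.Quotient.eq, ← Ideal.Quotient.mkₐ_eq_mk k]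
  change Ideal.Quotient.mkₐ k _ a =
    ((Ideal.Quotient.mkₐ k (Ideal.span {(X k₀ : MvPolynomial (Fin (n + 2)) k)})).comp
      ((unskip k₀).comp (aeval (skipSubst k₀)))) a
  congr 1
  refine MvPolynomial.algHom_ext fun i ↦ ?_
  rw [AlgHom.comp_apply, AlgHom.comp_apply]
  refine Fin.succAboveCases k₀ ?_ (fun j ↦ ?_) i
  · rw [aeval_X, skipSubst_self, map_zero, map_zero, Ideal.Quotient.mkₐ_eq_mk,
      Ideal.Quotient.eq_zero_iff_mem]
    exact Ideal.subset_span (Set.mem_singleton _)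
  · rw [aeval_X, skipSubst_succAbove, unskip, rename_X]

/-- For a prime `𝔭 ∋ x_{k₀}` of `k[x]`: `a ∈ 𝔭 ↔ unskip (s a) ∈ 𝔭`. [folklore] -/
theorem mem_iff_unskip_skipGraded_mem {p : Ideal (MvPolynomial (Fin (n + 2)) k)}
    (hp : (X k₀ : MvPolynomial (Fin (n + 2)) k) ∈ p) (a : MvPolynomial (Fin (n + 2)) k) :
    a ∈ p ↔ unskip k₀ (skipGraded k₀ a) ∈ p := by
  have hsub : a - unskip k₀ (skipGraded k₀ a) ∈ p :=
    (Ideal.span_le.2 (Set.singleton_subset_iff.2 hp)) (sub_unskip_skipGraded_mem k₀ a)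
  constructor
  · intro ha
    have := p.sub_mem ha hsub
    rwa [sub_sub_cancel] at this
  · intro ha
    have := p.add_mem hsub ha
    rwa [sub_add_cancel] at this

/-- **The preimage point**: for `𝔭 ∈ V₊(x_{k₀})`, the homogeneous prime `unskip⁻¹(𝔭)` of `k[y]`
is relevant, and is the point of `ℙⁿ` mapping to `𝔭`. [cite: Hartshorne1977, II Ex. 3.12] -/
def skipPreimagePoint (p : Proj 𝒜) (hp : (X k₀ : MvPolynomial (Fin (n + 2)) k) ∈ p.asHomogeneousIdeal) :
    Proj ℬ where
  asHomogeneousIdeal := p.asHomogeneousIdeal.comap (unskipGraded k₀)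
  isPrime := inferInstance
  not_irrelevant_le h := by
    -- then every variable `xᵢ` lies in `𝔭`, contradicting relevance of `𝔭`
    apply p.not_irrelevant_le
    intro a ha
    have hX : ∀ i, (X i : MvPolynomial (Fin (n + 2)) k) ∈ p.asHomogeneousIdeal := by
      intro i
      refine Fin.succAboveCases k₀ hp (fun j ↦ ?_) i
      have hy : (X j : MvPolynomial (Fin (n + 1)) k) ∈ HomogeneousIdeal.irrelevant ℬ :=
        HomogeneousIdeal.mem_irrelevant_of_mem _ one_pos (X_mem j)
      have := h hy
      change unskip k₀ (X j) ∈ p.asHomogeneousIdeal at this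
      rwa [unskip, rename_X] at this
    have ha' : a ∈ Ideal.span (Set.range (X : Fin (n + 2) → MvPolynomial (Fin (n + 2)) k)) :=
      irrelevant_le_span (n + 1) k ha
    exact (Ideal.span_le.2 (Set.range_subset_iff.2 hX)) ha'

/-- `skipMap` sends the preimage point to `𝔭` (`s⁻¹(unskip⁻¹ 𝔭) = 𝔭` for `𝔭 ∋ x_{k₀}`).
[cite: Hartshorne1977, II Ex. 3.12] -/
theorem skipMap_base_skipPreimagePoint (p : Proj 𝒜)
    (hp : (X k₀ : MvPolynomial (Fin (n + 2)) k) ∈ p.asHomogeneousIdeal) :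
    (skipMap k₀).left (skipPreimagePoint k₀ p hp) = p := by
  refine ProjectiveSpectrum.ext (HomogeneousIdeal.ext (Ideal.ext fun a ↦ ?_))
  change skipGraded k₀ a ∈ (skipPreimagePoint k₀ p hp).asHomogeneousIdeal ↔ a ∈ p.asHomogeneousIdeal
  change unskip k₀ (skipGraded k₀ a) ∈ p.asHomogeneousIdeal ↔ _
  exact (mem_iff_unskip_skipGraded_mem k₀ hp a).symm

/-- **The image of the coordinate embedding is the coordinate hyperplane `V₊(x_{k₀})`.**
[cite: Hartshorne1977, II Ex. 3.12] -/
theorem range_skipMap :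
    Set.range (skipMap (k := k) k₀).left = ProjectiveSpectrum.zeroLocus 𝒜 {X k₀} := by
  refine Set.Subset.antisymm (range_skipMap_subset k₀) fun p hp ↦ ?_
  have hp' : (X k₀ : MvPolynomial (Fin (n + 2)) k) ∈ p.asHomogeneousIdeal :=
    Set.singleton_subset_iff.1 hp
  exact ⟨skipPreimagePoint k₀ p hp', skipMap_base_skipPreimagePoint k₀ p hp'⟩

end Range

end ProjectiveSpace

end Literature.AlgebraicGeometry.Motives

end
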